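import Summits.BirchSwinnertonDyer.BirchSwinnertonDyer.Theorems.EdixhovenFibreFiveSevenTwistDegreeStepFiveSeven
import Summits.BirchSwinnertonDyer.BirchSwinnertonDyer.Theorems.EdixhovenFibreFiveSevenStarredOptimalManinUnitFiveSevenLeverAtManinUnit57
import Summits.BirchSwinnertonDyer.BirchSwinnertonDyer.Theorems.EdixhovenFibreFiveSevenStarredOptimalManinUnitFiveSevenAssemblyAt
import Summits.BirchSwinnertonDyer.BirchSwinnertonDyer.Theorems.EdixhovenFibreFiveSevenStarredOptimalManinUnitFiveSevenOrdinaryCellsDeRham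
import Literature.NumberTheory.EllipticCurves.IsogenyCompProofs
import Literature.NumberTheory.PAdicHodge.KatoH1BdRFilHolds
import HarnessLib

/-!
# Crux TDS57 `TwistDegreeStepFiveSeven` (stmt-BirchSwinnertonDyer-22227), route `EdixhovenFibreFiveSeven`: the twist-degree step
# OFF the Kosters–Pannekoek sub-residue GRANTED {P1, (S5b-tower)} and the de Rham-ness of ONE member — hence, on the
# (G)-ordinary unstarred cells, GRANTED {P1, (S5b-tower)} only

Cell `pub/bsd-wall`, seat `bsd-line-edix-p4` g9 (WIDTH-5, lane (g) of memo
`Cruxes/StarredOptimalManinUnitFiveSeven/Lines/kato-lever-hDR-rekey.md`). TOOL theorems only (no definition, no named fact, no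
`sorry`, no local instance); `--supports` 22227 (helper); nothing is closed; BSD is not proved by any of this.

WHAT. The tree's `TwistDegreeStepFiveSeven.twistDegreeStep57_of_kato_of_noTorsion` (p ∈ {5, 7}, `V` additive with no `Iₙ*`
fibre, `ord_p Δ_min(V) ≤ 4`, `E[p]` irreducible, NO member of the class with a `ℚ_p`-rational point of order `p`) takes the
UNIVERSAL cite-only fact F″; but it reads F″ only at the `X₀(N)`-optimal member of the class of `V`
(`exists_member_not_dvd_c_of_tameTwist57`). With the per-class socket (`KatoAssemblySocketAt`, p651700) and the per-curve
57-lever (`ManinFrameResidueProperRTameTwistAt`, p652467) the de Rham input becomes PER CLASS: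

* `ManinFrameResidueProperRTameTwistAt.exists_member_not_dvd_c_of_tameTwist57_at` — the member statement of
  `…RTameTwistFull57` (p579959) with `hK` := the body of F″ at every globally minimal `W₀ ∼ W`.
* ★ `twistDegreeStep57_of_sl2NeronValues_of_noTorsion_of_isDeRhamAt` — the conclusion of TDS57 at `(p, V, W♭)` off the
  KP sub-residue, GRANTED P1, hT₂, modularity and «`V_pV|_{Γ_{ℚ_v}}` is de Rham» for THIS `V` (moved along the class by
  `DeRhamEllipticIsogeny`, p650458).
* ★ `twistDegreeStep57_of_sl2NeronValues_of_noTorsion_of_typeGOrd` — the same for a (G)-ORDINARY `V` GRANTED ONLY P1, hT₂ and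
  modularity: de Rham by the tree theorem `isDeRham_restrictedRationalTateRep_adicCompletion_rat_of_typeGOrd` (p646289). On TDS57's
  locus the (G)-ordinary cells are `(5; III)`, `(7; II)`, `(7; IV)`; off-KP along the class is a theorem on type IV and on
  `(7; III)` (`forall_member_noTorsion_of_kodaira_IV_or_III_at_seven`, Dokchitser–Dokchitser), so the cell `(7; IV)` of TDS57 is
  conditional on {P1, hT₂, modularity, DD 5.1(1)} only — no Fontaine.
CONDITIONAL; the item stays OPEN (its other cells are potentially supersingular or on the KP sub-residue).

References: [Kato2004Asterisque] (8.1.3) p. 180, Thm. 9.7 p. 189; [KimNakamura2020] Cor. 2.4; [KostersPannekoek2017] Thm. 1, Cor. 2;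
[EdixhovenManin1991] §4; [ZagierCMB1985] §1; [Kato1993LNM1553] Ch. II Ex. 1.3.5; [DokchitserDokchitser2015LocalInvariants] Thm. 3.2.
-/

set_option autoImplicit false
-- the Theorems namespace of a single-conjunct summit repeats the summit name by design (D-0017)
set_option linter.dupNamespace false

noncomputable section

open scoped Classical MatrixGroups NumberField

open WeierstrassCurve NumberField IsDedekindDomain Field ValuativeRel
  Literature.NumberTheory.EllipticCurves Literature.NumberTheory.EllipticCurves.ModularForms
  Literature.NumberTheory.EllipticCurves.Rank1Residual Literature.NumberTheory.EllipticCurves.Kato2004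
  Literature.NumberTheory.DiophantineGeometry Rat.HeightOneSpectrum
  Literature.NumberTheory.PAdicHodge Literature.NumberTheory.GaloisRepresentations
  Literature.NumberTheory.GaloisRepresentations.IsNonarchimedeanLocalField
  Summit.BirchSwinnertonDyer.Rank1Residual Summit.BirchSwinnertonDyer.Rank1Residual.Additive
  Summit.BirchSwinnertonDyer.BirchSwinnertonDyer.Theorems
  Summit.BirchSwinnertonDyer.BirchSwinnertonDyer.Theorems.KatoAssemblySocketAt
  CongruenceSubgroup Complex

namespace Summit.BirchSwinnertonDyer.BirchSwinnertonDyer.Theorems.ManinFrameResidueProperRTameTwistAt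

open Summit.BirchSwinnertonDyer.BirchSwinnertonDyer.Theorems.ManinFrameResidueProperRTameTwist

variable {p : ℕ} [hp : Fact p.Prime]

/-- **A member with a Manin-unit conductor-level datum at `p ∈ {5, 7}` off the Kosters–Pannekoek exception, from the body of
F″ at the members of the class** (`…RTameTwistFull57.exists_member_not_dvd_c_of_tameTwist57` re-keyed per class): the
`X₀(N)`-optimal member `W₀ ∼ W` has `p ∤ c₀` by `not_dvd_c_of_tameTwist57_at` fed with `hK W₀`.
[cite: EdixhovenManin1991, §4 (cases 1/2)] [cite: KostersPannekoek2017, Thm. 1 and Cor. 2] -/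
theorem exists_member_not_dvd_c_of_tameTwist57_at
    (hnf : exists_isNewformOf) (W : WeierstrassCurve ℚ) [W.IsElliptic] [W.IsGloballyMinimal]
    [NeZero (W.conductorNorm ℤ)] (hp57 : p = 5 ∨ p = 7) (hadd : Addv W p) (hirr : Irr W p)
    (hPT : ∀ (W' : WeierstrassCurve ℚ) [W'.IsElliptic] [W'.IsGloballyMinimal], IsIsogenous W W' →
      ∀ P : (W'.baseChange ℚ_[p]).toAffine.Point, p • P = 0 → P = 0)
    (hK : ∀ (W₀ : WeierstrassCurve ℚ) [W₀.IsElliptic] [W₀.IsGloballyMinimal], IsIsogenous W W₀ →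
      ∀ {M : ℕ} [NeZero M] (g : CuspForm (Gamma0 M) 2), IsNewformOf W₀ g → 5 ≤ p →
      ¬ W₀.HasGoodReductionAtPrime p → ¬ W₀.HasMultiplicativeReductionAtPrime p →
      W₀.HasIrreducibleModPGaloisRep p → ∀ (m : ℕ) [NeZero m], m.Coprime (p * M) →
      (7 < p ∨ (Nat.Coprime (orderOf (p : ZMod m)) (p - 1) ∧
        ∀ P : (W₀.baseChange ℚ_[p]).toAffine.Point, p • P = 0 → P = 0)) →
      ∀ (χ : DirichletCharacter ℂ m), χ.IsPrimitive → χ ≠ 1 → ¬ p ∣ orderOf χ → ∀ (ϖ : ℚ) (r : ℂ),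
      (χ.Even → (ϖ : ℝ) * W₀.realPeriodRat = plusPeriod g →
        (∏ ℓ ∈ M.primeFactors with ¬ ℓ ^ 2 ∣ M,
            (((ℓ : ℂ) - (W₀.LFunction ℓ : ℂ) * χ (ℓ : ZMod m)) *
              ((ℓ : ℂ) - (W₀.LFunction ℓ : ℂ) * (χ (ℓ : ZMod m))⁻¹))) *
            twistedSymbolSum g χ = r * (plusPeriod g : ℂ) →
        ∃ s : ℕ, ¬ p ∣ s ∧ IsIntegral ℤ ((s : ℂ) * ϖ * r)) ∧
      (χ.Odd → (ϖ : ℝ) * W₀.imaginaryPeriodRat = minusPeriod g →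
        (∏ ℓ ∈ M.primeFactors with ¬ ℓ ^ 2 ∣ M,
            (((ℓ : ℂ) - (W₀.LFunction ℓ : ℂ) * χ (ℓ : ZMod m)) *
              ((ℓ : ℂ) - (W₀.LFunction ℓ : ℂ) * (χ (ℓ : ZMod m))⁻¹))) *
            twistedSymbolSum g χ = r * (minusPeriod g : ℂ) * Complex.I →
        ∃ s : ℕ, ¬ p ∣ s ∧ IsIntegral ℤ ((s : ℂ) * ϖ * r))) :
    ∃ (W₀ : WeierstrassCurve ℚ) (_ : W₀.IsElliptic) (_ : W₀.IsGloballyMinimal)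
      (D₀ : ModularParametrizationData W₀ (W.conductorNorm ℤ)),
      IsIsogenous W W₀ ∧ ¬ (p : ℤ) ∣ D₀.c := by
  obtain ⟨W₀, hE₀, hM₀, hNe₀, D₀'', hiso, hN, hopt''⟩ := X12.exists_isIsogenous_optimal hnf W
  haveI := hE₀
  haveI := hM₀
  haveI := hNe₀
  obtain ⟨D₀', hopt'⟩ := X12.exists_optimalDatum_of_level_eq hN D₀'' hopt''
  have hiso₀ : IsIsogenous W₀ W := hiso.symm_of_charZero
  have hL : W₀.LFunction = W.LFunction := hiso₀.LFunction_eq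
  have hadd₀ : Addv W₀ p := (X2.addv_iff_of_isIsogenous (p := p) hiso).mp hadd
  have hirr₀ : Irr W₀ p := (X12.irr_iff_of_isIsogenous hiso p).mp hirr
  have hpN : p ^ 2 ∣ W.conductorNorm ℤ := sq_dvd_conductorNorm_of_not_good_of_not_mult hadd
  have ha : ∀ ℓ ∈ (W.conductorNorm ℤ).primeFactors, ¬ ℓ ^ 2 ∣ W.conductorNorm ℤ →
      W₀.LFunction ℓ = 1 ∨ W₀.LFunction ℓ = -1 := by
    intro ℓ hℓ hℓ2
    haveI : Fact ℓ.Prime := ⟨Nat.prime_of_mem_primeFactors hℓ⟩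
    rw [hL]
    rcases hasGoodReductionAtPrime_or_hasMultiplicativeReductionAtPrime_of_not_sq_dvd_conductorNorm (V := W) hℓ2
      with hg | hmul
    · exact absurd (Nat.dvd_of_mem_primeFactors hℓ) (not_dvd_conductorNorm_of_hasGoodReductionAtPrime W hg)
    · exact KrausOesterle1992.lFunction_apply_prime_eq_one_or_eq_neg_one_of_mult W ℓ hmul
  exact ⟨W₀, hE₀, hM₀, D₀', hiso,
    not_dvd_c_of_tameTwist57_at hp57 W₀ (hK W₀ hiso) D₀' hopt' (hPT W₀ hiso) hadd₀ hirr₀ hpN ha⟩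

end Summit.BirchSwinnertonDyer.BirchSwinnertonDyer.Theorems.ManinFrameResidueProperRTameTwistAt

namespace Summit.BirchSwinnertonDyer.BirchSwinnertonDyer.Theorems.TwistDegreeStepFiveSevenOfSL2NeronValues

open Summit.BirchSwinnertonDyer.BirchSwinnertonDyer.Theorems.ManinFrameResidueProperRTameTwistAt
open Summit.BirchSwinnertonDyer.BirchSwinnertonDyer.Theorems.TwistDegreeStepFiveSeven

variable {p : ℕ} [hp : Fact p.Prime]

/-- ★ **The twist-degree step at `(p, V, W♭)` off the Kosters–Pannekoek sub-residue, GRANTED P1, (S5b-tower), modularity and the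
de Rham-ness of `V_pV|_{Γ_{ℚ_v}}` of THIS `V`** (`twistDegreeStep57_of_kato_of_noTorsion` with F″ replaced by its body at the
members of the class: per-class socket `katoNeronBody_of_sl2NeronValues_of_isDeRhamAt` — Prop. 1.2.3 by
`cupLogInjective_and_hasDualExp_of_isDeRham_holds`, de Rham moved along the class by `isDeRham_restrictedRationalTateRep_of_isIsogenous`).
[cite: Kato2004Asterisque, (8.1.3) (p. 180), Thm. 9.7 (p. 189)] [cite: KostersPannekoek2017, Thm. 1 and Cor. 2]
[cite: ZagierCMB1985, §1 (p. 374)] [cite: Kato1993LNM1553, Ch. II Ex. 1.3.5] -/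
theorem twistDegreeStep57_of_sl2NeronValues_of_noTorsion_of_isDeRhamAt
    (hT₂ : exists_smul_range_expStarCoord_tower_iff_trace_log) (hP1 : exists_member_sl2ZetaElement_neron_values)
    (hnf : exists_isNewformOf)
    (V : WeierstrassCurve ℚ) [V.IsElliptic] [V.IsGloballyMinimal] [NeZero (V.conductorNorm ℤ)]
    (Wf : WeierstrassCurve ℚ) [Wf.IsElliptic] [Wf.IsGloballyMinimal] [NeZero (Wf.conductorNorm ℤ)]
    (C : VariableChange ℚ) (hp57 : p = 5 ∨ p = 7) (hadd : Addv V p) (hirr : Irr V p)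
    (hK : ∀ (v : HeightOneSpectrum ℤ) (n : ℕ), natGenerator v = p → V.kodairaSymbolAt v ≠ KodairaSymbol.Istar n)
    (hV4 : padicValInt p V.minimalDiscriminantInt ≤ 4)
    (hC : C • V.quadraticTwist ((-1 : ℚ) ^ (p / 2) * p) = Wf)
    (hPT : ∀ (W' : WeierstrassCurve ℚ) [W'.IsElliptic] [W'.IsGloballyMinimal], IsIsogenous V W' →
      ∀ P : (W'.baseChange ℚ_[p]).toAffine.Point, p • P = 0 → P = 0)
    (hDRV : ∀ (v : HeightOneSpectrum (𝓞 ℚ)), ((p : ℕ) : 𝓞 ℚ) ∈ v.asIdeal →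
      ∀ [CharZero (v.adicCompletion ℚ)] [Fact (¬ IsUnit (p : integerC (v.adicCompletion ℚ)))]
        [IsAdicComplete (Ideal.span {(p : integerC (v.adicCompletion ℚ))}) (integerC (v.adicCompletion ℚ))]
        (hp' : valuation (v.adicCompletion ℚ) p < 1) [Algebra ℚ_[p] (v.adicCompletion ℚ)],
        GaloisRep.IsDeRham (bdRPeriodRingData (F := v.adicCompletion ℚ) (p := p) hp')
          (restrictedRationalTateRep V (v.adicCompletion ℚ) p)) :
    ∃ D : ModularParametrizationData V (V.conductorNorm ℤ),
      ∀ Df : ModularParametrizationData Wf (Wf.conductorNorm ℤ),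
        padicValNat p D.modularDegree < padicValNat p Df.modularDegree := by
  obtain ⟨W₀, hE₀, hM₀, D₀, hiso, hc₀⟩ := exists_member_not_dvd_c_of_tameTwist57_at hnf V hp57 hadd hirr hPT (by
    intro W₀ _ _ hiso₀ M _ g hg hp5 hng hnm hirr' m _ hcop hcl χ hχ hχ1 hord ϖ r
    refine katoNeronBody_of_sl2NeronValues_of_isDeRhamAt hT₂ cupLogInjective_and_hasDualExp_of_isDeRham_holds hP1 W₀ p
      ?_ g hg hp5 hng hnm hirr' m hcop hcl χ hχ hχ1 hord ϖ r
    intro v hpv _ _ _ hp' _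
    exact isDeRham_restrictedRationalTateRep_of_isIsogenous hp' hiso₀ (hDRV v hpv hp'))
  haveI := hE₀
  haveI := hM₀
  obtain ⟨D, hc⟩ :=
    ManinFrameTransport.exists_modularParametrizationData_not_dvd_of_partner V hp.out hirr hiso D₀ hc₀
  exact ⟨D, twistDegreeStep57_of_not_dvd_c (by rcases hp57 with rfl | rfl <;> norm_num) V Wf hadd hK hV4 C hC D hc⟩

/-- ★ **The same for a (G)-ORDINARY `V`, GRANTED ONLY P1, (S5b-tower) and modularity**: the de Rham input is the tree theorem
`isDeRham_restrictedRationalTateRep_adicCompletion_rat_of_typeGOrd`. On TDS57's locus (`ord_p Δ_min ≤ 4`, no `Iₙ*`) the (G)-ordinary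
cells are `(5; III)`, `(7; II)`, `(7; IV)`. CONDITIONAL; nothing closed.
[cite: Kato2004Asterisque, (8.1.3) (p. 180), Thm. 9.7 (p. 189)] [cite: DokchitserDokchitser2015LocalInvariants, Thm. 3.2]
[cite: Kato1993LNM1553, Ch. II Ex. 1.3.5] -/
theorem twistDegreeStep57_of_sl2NeronValues_of_noTorsion_of_typeGOrd
    (hT₂ : exists_smul_range_expStarCoord_tower_iff_trace_log) (hP1 : exists_member_sl2ZetaElement_neron_values)
    (hnf : exists_isNewformOf)
    (V : WeierstrassCurve ℚ) [V.IsElliptic] [V.IsGloballyMinimal] [NeZero (V.conductorNorm ℤ)]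
    (Wf : WeierstrassCurve ℚ) [Wf.IsElliptic] [Wf.IsGloballyMinimal] [NeZero (Wf.conductorNorm ℤ)]
    (C : VariableChange ℚ) (hp57 : p = 5 ∨ p = 7) (hadd : Addv V p) (hirr : Irr V p)
    (hK : ∀ (v : HeightOneSpectrum ℤ) (n : ℕ), natGenerator v = p → V.kodairaSymbolAt v ≠ KodairaSymbol.Istar n)
    (hV4 : padicValInt p V.minimalDiscriminantInt ≤ 4)
    (hC : C • V.quadraticTwist ((-1 : ℚ) ^ (p / 2) * p) = Wf)
    (hPT : ∀ (W' : WeierstrassCurve ℚ) [W'.IsElliptic] [W'.IsGloballyMinimal], IsIsogenous V W' →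
      ∀ P : (W'.baseChange ℚ_[p]).toAffine.Point, p • P = 0 → P = 0)
    (hG : TypeGOrd V p) :
    ∃ D : ModularParametrizationData V (V.conductorNorm ℤ),
      ∀ Df : ModularParametrizationData Wf (Wf.conductorNorm ℤ),
        padicValNat p D.modularDegree < padicValNat p Df.modularDegree :=
  twistDegreeStep57_of_sl2NeronValues_of_noTorsion_of_isDeRhamAt hT₂ hP1 hnf V Wf C hp57 hadd hirr hK hV4 hC hPT
    (fun v hpv _ _ _ hp' _ ↦ isDeRham_restrictedRationalTateRep_adicCompletion_rat_of_typeGOrd V p hG v hpv hp')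

end Summit.BirchSwinnertonDyer.BirchSwinnertonDyer.Theorems.TwistDegreeStepFiveSevenOfSL2NeronValues

end
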